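import Summits.CriticalPhenomena.PercolationContinuityZ3.Theorems.PercNearOneGluingAdditiveGluingBlockGoodPeelLayers
import HarnessLib

/-! # Crux `PercNearOneGluing.AdditiveGluing` (stmt-CriticalPhenomena-4576), stub `stub_goodStep` — H5 `blockGood_peel`:
# block goodness propagates from the children of the σ-peel at a block vertex (STUB-PLAN Line A, part 2)

Stub-plan prover; lands `--supports stmt-CriticalPhenomena-4576`; no definitions, no named facts.

**`blockGood_peel`.**  `BG(u, A, S, b, a₀, sel)` denotes the block-goodness inequality of the un-glued graph
(`μ(a₀↔b) + μ(a₀↮b, a₀↔S, S↔b) ≤ μ(S↔b) + Σ_{W∩A=∅} μ(K_S = W)·μ(sel W ↔ b in Wᶜ)`).  Let `x ∈ S ∖ A`.  If for every layer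
`S'` of the open star of `x` of positive probability the CHILD block `(S.erase x) ∪ S'` is good in the graph `u − x` (the pairs at `x`
killed) with the shifted selection `sel ∘ insert x`, then `S` is good in `u`.  Indeed BG decomposes EXACTLY over the layers: on
`{open star of x = S'}` the block events of `S` are the block events of the child block of the configuration off `x` with `S'` glued
(part 1, `peel_*_iff`), whose law is `(u − x)/S'` (`stub_sigmaLaw`), under which the block data of the child have the same law as under
`u − x` (part 1, `peel_real_*_eq`); the pockets re-index by `W ↦ W.erase x`.  This is the internal node of the peeling certificate
(plan Line A; leaves: `blockGood_leaf_lemma5`, `blockGood_leaf_ih`). [cite: KozmaNitzan2024, §3.2 (pp. 12–14)]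
-/

namespace Summit.CriticalPhenomena.PercolationContinuityZ3.Theorems

open MeasureTheory Set Filter
open Literature.Probability.LatticeModels (prodBernoulli)
open Literature.Probability.Percolation (BondConfig openConn openConnIn openGraph openCluster)
open scoped BigOperators

noncomputable section
open Classical

section BlockGoodPeel

open Literature.Probability.LatticeModels Literature.Probability.Percolation

variable {n : ℕ}

/-- A layer containing `x` itself is empty. [folklore] -/
theorem peel_layer_eq_empty (S' : Finset (Fin n)) (x : Fin n) (hxS' : x ∈ S') :
    {ω : BondConfig (Fin n) | ∀ y : Fin n, y ∈ S' ↔ (y ∉ ({x} : Finset (Fin n)) ∧ ∃ o ∈ ({x} : Finset (Fin n)), s(o, y) ∈ ω)} = ∅ :=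
  Set.eq_empty_of_forall_notMem fun _ hω => ((hω x).1 hxS').1 (Finset.mem_singleton_self x)

/-- **H5 — block goodness propagates from the children of the σ-peel at a block vertex.**  See the module docstring.
[cite: KozmaNitzan2024, §3.2 (pp. 12–14)] -/
theorem blockGood_peel (u : Sym2 (Fin n) → unitInterval) (A S : Finset (Fin n)) (b a₀ x : Fin n)
    (sel : Finset (Fin n) → Fin n) (hx : x ∈ S) (hxA : x ∉ A) (hbA : b ∈ A) (ha₀A : a₀ ∈ A)
    (hsel : ∀ W, sel W ∈ A)
    (hlayers : ∀ S' : Finset (Fin n), (prodBernoulli u).real {ω : BondConfig (Fin n) | ∀ y : Fin n, y ∈ S' ↔ (y ∉ ({x} : Finset (Fin n)) ∧ ∃ o ∈ ({x} : Finset (Fin n)), s(o, y) ∈ ω)} ≠ 0 →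
        (prodBernoulli (fun e : Sym2 (Fin n) => if ∃ y ∈ ({x} : Finset (Fin n)), y ∈ e then (0 : unitInterval) else u e)).real (openConn a₀ b)
          + (prodBernoulli (fun e : Sym2 (Fin n) => if ∃ y ∈ ({x} : Finset (Fin n)), y ∈ e then (0 : unitInterval) else u e)).real
              ((openConn a₀ b)ᶜ ∩ (⋃ t ∈ (S.erase x ∪ S'), openConn a₀ t) ∩ (⋃ t ∈ (S.erase x ∪ S'), openConn t b))
        ≤ (prodBernoulli (fun e : Sym2 (Fin n) => if ∃ y ∈ ({x} : Finset (Fin n)), y ∈ e then (0 : unitInterval) else u e)).real (⋃ t ∈ (S.erase x ∪ S'), openConn t b)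
          + ∑ W' ∈ ((Finset.univ : Finset (Finset (Fin n))).filter (fun W => Disjoint W A)),
              (prodBernoulli (fun e : Sym2 (Fin n) => if ∃ y ∈ ({x} : Finset (Fin n)), y ∈ e then (0 : unitInterval) else u e)).real {ω : BondConfig (Fin n) | ∀ z : Fin n, (z ∈ W' ↔ ω ∈ ⋃ t ∈ (S.erase x ∪ S'), openConn t z)}
                * (prodBernoulli (fun e : Sym2 (Fin n) => if ∃ y ∈ ({x} : Finset (Fin n)), y ∈ e then (0 : unitInterval) else u e)).real (openConnIn ((W' : Set (Fin n))ᶜ) (sel (insert x W')) b)) :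
    (prodBernoulli u).real (openConn a₀ b)
        + (prodBernoulli u).real
            ((openConn a₀ b)ᶜ ∩ (⋃ s ∈ S, openConn a₀ s) ∩ (⋃ s ∈ S, openConn s b))
      ≤ (prodBernoulli u).real (⋃ s ∈ S, openConn s b)
        + ∑ W ∈ ((Finset.univ : Finset (Finset (Fin n))).filter (fun W => Disjoint W A)),
            (prodBernoulli u).real {ω : BondConfig (Fin n) | ∀ z : Fin n, (z ∈ W ↔ ω ∈ ⋃ s ∈ S, openConn s z)}
              * (prodBernoulli u).real (openConnIn ((W : Set (Fin n))ᶜ) (sel W) b) := by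
  have hax : a₀ ≠ x := fun h => hxA (h ▸ ha₀A)
  have hbx : b ≠ x := fun h => hxA (h ▸ hbA)
  have hmem𝒟 : ∀ W, W ∈ ((Finset.univ : Finset (Finset (Fin n))).filter (fun W => Disjoint W A)) ↔ Disjoint W A := fun W => by simp
  -- the layer law (seat k24's `stub_sigmaLaw` with the singleton block; `glue u {x} = u`)
  have hlaw : ∀ (S' : Finset (Fin n)) (E : Set (BondConfig (Fin n))),
      (prodBernoulli u).real ({ω : BondConfig (Fin n) | ∀ y : Fin n, y ∈ S' ↔ (y ∉ ({x} : Finset (Fin n)) ∧ ∃ o ∈ ({x} : Finset (Fin n)), s(o, y) ∈ ω)} ∩ {ω | (({e | e ∈ ω ∧ ∀ y ∈ e, y ∉ ({x} : Finset (Fin n))} ∪ {e | (∀ y ∈ e, y ∈ S') ∧ ¬ e.IsDiag} : BondConfig (Fin n))) ∈ E}) =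
        (prodBernoulli u).real {ω : BondConfig (Fin n) | ∀ y : Fin n, y ∈ S' ↔ (y ∉ ({x} : Finset (Fin n)) ∧ ∃ o ∈ ({x} : Finset (Fin n)), s(o, y) ∈ ω)} * (prodBernoulli (fun e : Sym2 (Fin n) => if (∀ y ∈ e, y ∈ S') ∧ ¬ e.IsDiag then (1 : unitInterval) else if (∃ y ∈ e, y ∈ ({x} : Finset (Fin n))) then 0 else u e)).real E := by
    intro S' E
    have h := stub_sigmaLaw n u ({x} : Finset (Fin n)) S' E
    rw [goodStep24_glue_singleton u x] at h
    exact h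
  have hfac : ∀ (S' : Finset (Fin n)) (F F' : Set (BondConfig (Fin n))),
      (∀ ω : BondConfig (Fin n), (∀ y : Fin n, y ∈ S' ↔ (y ∉ ({x} : Finset (Fin n)) ∧
          ∃ o ∈ ({x} : Finset (Fin n)), s(o, y) ∈ ω)) → (ω ∈ F ↔ (({e | e ∈ ω ∧ ∀ y ∈ e, y ∉ ({x} : Finset (Fin n))} ∪ {e | (∀ y ∈ e, y ∈ S') ∧ ¬ e.IsDiag} : BondConfig (Fin n))) ∈ F')) →
      (prodBernoulli u).real ({ω : BondConfig (Fin n) | ∀ y : Fin n, y ∈ S' ↔ (y ∉ ({x} : Finset (Fin n)) ∧ ∃ o ∈ ({x} : Finset (Fin n)), s(o, y) ∈ ω)} ∩ F) = (prodBernoulli u).real {ω : BondConfig (Fin n) | ∀ y : Fin n, y ∈ S' ↔ (y ∉ ({x} : Finset (Fin n)) ∧ ∃ o ∈ ({x} : Finset (Fin n)), s(o, y) ∈ ω)} * (prodBernoulli (fun e : Sym2 (Fin n) => if (∀ y ∈ e, y ∈ S') ∧ ¬ e.IsDiag then (1 : unitInterval) else if (∃ y ∈ e, y ∈ ({x} :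 Finset (Fin n))) then 0 else u e)).real F' := by
    intro S' F F' hFF'
    rw [← hlaw S' F']
    congr 1
    ext ω
    simp only [Set.mem_inter_iff, Set.mem_setOf_eq]
    exact ⟨fun h => ⟨h.1, (hFF' ω h.1).1 h.2⟩, fun h => ⟨h.1, (hFF' ω h.1).2 h.2⟩⟩
  -- (1)+(2) the left side through the star
  have hL1 : (prodBernoulli u).real (openConn a₀ b) = ∑ S' : Finset (Fin n),
      (prodBernoulli u).real {ω : BondConfig (Fin n) | ∀ y : Fin n, y ∈ S' ↔ (y ∉ ({x} : Finset (Fin n)) ∧ ∃ o ∈ ({x} : Finset (Fin n)), s(o, y) ∈ ω)} * (prodBernoulli (fun e : Sym2 (Fin n) => if (∀ y ∈ e, y ∈ S') ∧ ¬ e.IsDiag then (1 : unitInterval) else if (∃ y ∈ e, y ∈ ({x} : Finset (Fin n))) then 0 else u e)).real (openConn a₀ b) := by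
    rw [sigmaRec_partition u ({x} : Finset (Fin n))]
    exact Finset.sum_congr rfl fun S' _ => hfac S' _ _ fun ω hLω => peel_openConn_iff S' x a₀ b hax hbx ω hLω
  have hL2 : (prodBernoulli u).real ((openConn a₀ b)ᶜ ∩ (⋃ s ∈ S, openConn a₀ s) ∩ (⋃ s ∈ S, openConn s b)) =
      ∑ S' : Finset (Fin n), (prodBernoulli u).real {ω : BondConfig (Fin n) | ∀ y : Fin n, y ∈ S' ↔ (y ∉ ({x} : Finset (Fin n)) ∧ ∃ o ∈ ({x} : Finset (Fin n)), s(o, y) ∈ ω)} * (prodBernoulli (fun e : Sym2 (Fin n) => if (∀ y ∈ e, y ∈ S') ∧ ¬ e.IsDiag then (1 : unitInterval) else if (∃ y ∈ e, y ∈ ({x} : Finset (Fin n))) then 0 else u e)).real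
        ((openConn a₀ b)ᶜ ∩ (⋃ t ∈ (S.erase x ∪ S'), openConn a₀ t) ∩ (⋃ t ∈ (S.erase x ∪ S'), openConn t b)) := by
    rw [sigmaRec_partition u ({x} : Finset (Fin n))]
    refine Finset.sum_congr rfl fun S' _ => hfac S' _ _ fun ω hLω => ?_
    simp only [Set.mem_inter_iff, Set.mem_compl_iff]
    rw [peel_openConn_iff S' x a₀ b hax hbx ω hLω, peel_conn_exists_iff S S' x a₀ hx hax ω hLω,
      peel_exists_conn_iff S S' x b hx hbx ω hLω]
  have hY : (prodBernoulli u).real (⋃ s ∈ S, openConn s b) = ∑ S' : Finset (Fin n),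
      (prodBernoulli u).real {ω : BondConfig (Fin n) | ∀ y : Fin n, y ∈ S' ↔ (y ∉ ({x} : Finset (Fin n)) ∧ ∃ o ∈ ({x} : Finset (Fin n)), s(o, y) ∈ ω)} * (prodBernoulli (fun e : Sym2 (Fin n) => if (∀ y ∈ e, y ∈ S') ∧ ¬ e.IsDiag then (1 : unitInterval) else if (∃ y ∈ e, y ∈ ({x} : Finset (Fin n))) then 0 else u e)).real (⋃ t ∈ (S.erase x ∪ S'), openConn t b) := by
    rw [sigmaRec_partition u ({x} : Finset (Fin n))]
    exact Finset.sum_congr rfl fun S' _ => hfac S' _ _ fun ω hLω => peel_exists_conn_iff S S' x b hx hbx ω hLω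
  -- (4) the pockets through the star
  have hP : ∀ W : Finset (Fin n), x ∈ W → (prodBernoulli u).real {ω : BondConfig (Fin n) | ∀ z : Fin n, (z ∈ W ↔ ω ∈ ⋃ s ∈ S, openConn s z)} = ∑ S' : Finset (Fin n),
      (prodBernoulli u).real {ω : BondConfig (Fin n) | ∀ y : Fin n, y ∈ S' ↔ (y ∉ ({x} : Finset (Fin n)) ∧ ∃ o ∈ ({x} : Finset (Fin n)), s(o, y) ∈ ω)} * (prodBernoulli (fun e : Sym2 (Fin n) => if (∀ y ∈ e, y ∈ S') ∧ ¬ e.IsDiag then (1 : unitInterval) else if (∃ y ∈ e, y ∈ ({x} : Finset (Fin n))) then 0 else u e)).real {ω : BondConfig (Fin n) | ∀ z : Fin n, (z ∈ (W.erase x) ↔ ω ∈ ⋃ t ∈ (S.erase x ∪ S'), openConn t z)} := by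
    intro W hxW
    rw [sigmaRec_partition u ({x} : Finset (Fin n))]
    refine Finset.sum_congr rfl fun S' _ => ?_
    by_cases hxS' : x ∈ S'
    · rw [peel_layer_eq_empty S' x hxS', Set.empty_inter, measureReal_empty, zero_mul]
    · exact hfac S' _ _ fun ω hLω => peel_pocket_iff S S' W x hx hxS' hxW ω hLω
  -- positive layers avoid `x`
  have hposx : ∀ S' : Finset (Fin n), (prodBernoulli u).real {ω : BondConfig (Fin n) | ∀ y : Fin n, y ∈ S' ↔ (y ∉ ({x} : Finset (Fin n)) ∧ ∃ o ∈ ({x} : Finset (Fin n)), s(o, y) ∈ ω)} ≠ 0 → x ∉ S' := by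
    intro S' hne hxS'
    exact hne (by rw [peel_layer_eq_empty S' x hxS', measureReal_empty])
  -- the parent pocket sum, through the star and re-indexed
  have hPsum : ∑ W ∈ ((Finset.univ : Finset (Finset (Fin n))).filter (fun W => Disjoint W A)), (prodBernoulli u).real {ω : BondConfig (Fin n) | ∀ z : Fin n, (z ∈ W ↔ ω ∈ ⋃ s ∈ S, openConn s z)} * (prodBernoulli u).real (openConnIn ((W : Set (Fin n))ᶜ) (sel W) b) =
      ∑ S' : Finset (Fin n), (prodBernoulli u).real {ω : BondConfig (Fin n) | ∀ y : Fin n, y ∈ S' ↔ (y ∉ ({x} : Finset (Fin n)) ∧ ∃ o ∈ ({x} : Finset (Fin n)), s(o, y) ∈ ω)} *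
        ∑ W' ∈ ((Finset.univ : Finset (Finset (Fin n))).filter (fun W => Disjoint W A)), (prodBernoulli (fun e : Sym2 (Fin n) => if (∀ y ∈ e, y ∈ S') ∧ ¬ e.IsDiag then (1 : unitInterval) else if (∃ y ∈ e, y ∈ ({x} : Finset (Fin n))) then 0 else u e)).real {ω : BondConfig (Fin n) | ∀ z : Fin n, (z ∈ W' ↔ ω ∈ ⋃ t ∈ (S.erase x ∪ S'), openConn t z)}
          * (prodBernoulli (fun e : Sym2 (Fin n) => if ∃ y ∈ ({x} : Finset (Fin n)), y ∈ e then (0 : unitInterval) else u e)).real (openConnIn ((W' : Set (Fin n))ᶜ) (sel (insert x W')) b) := by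
    -- drop the pockets without `x`, rewrite the others through the star
    have h1 : ∑ W ∈ ((Finset.univ : Finset (Finset (Fin n))).filter (fun W => Disjoint W A)), (prodBernoulli u).real {ω : BondConfig (Fin n) | ∀ z : Fin n, (z ∈ W ↔ ω ∈ ⋃ s ∈ S, openConn s z)} * (prodBernoulli u).real (openConnIn ((W : Set (Fin n))ᶜ) (sel W) b) =
        ∑ W ∈ ((Finset.univ : Finset (Finset (Fin n))).filter (fun W => Disjoint W A)).filter (fun W => x ∈ W), ∑ S' : Finset (Fin n), (prodBernoulli u).real {ω : BondConfig (Fin n) | ∀ y : Fin n, y ∈ S' ↔ (y ∉ ({x} : Finset (Fin n)) ∧ ∃ o ∈ ({x} : Finset (Fin n)), s(o, y) ∈ ω)} *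
          ((prodBernoulli (fun e : Sym2 (Fin n) => if (∀ y ∈ e, y ∈ S') ∧ ¬ e.IsDiag then (1 : unitInterval) else if (∃ y ∈ e, y ∈ ({x} : Finset (Fin n))) then 0 else u e)).real {ω : BondConfig (Fin n) | ∀ z : Fin n, (z ∈ (W.erase x) ↔ ω ∈ ⋃ t ∈ (S.erase x ∪ S'), openConn t z)}
            * (prodBernoulli (fun e : Sym2 (Fin n) => if ∃ y ∈ ({x} : Finset (Fin n)), y ∈ e then (0 : unitInterval) else u e)).real (openConnIn ((↑(W.erase x) : Set (Fin n))ᶜ) (sel (insert x (W.erase x))) b)) := by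
      conv_rhs => rw [Finset.sum_filter]
      refine Finset.sum_congr rfl fun W hW => ?_
      by_cases hxW : x ∈ W
      · rw [if_pos hxW, hP W hxW, Finset.sum_mul]
        refine Finset.sum_congr rfl fun S' _ => ?_
        rw [Finset.insert_erase hxW, peel_real_factor_eq u W x (sel W) b hxW (fun h => hxA (h ▸ hsel W))]
        ring
      · rw [if_neg hxW, blockPocket_eq_empty S W x hx hxW, measureReal_empty, zero_mul]
    -- re-index `W ↦ W.erase x`
    have h2 : ∀ S' : Finset (Fin n), x ∉ S' →
        ∑ W ∈ ((Finset.univ : Finset (Finset (Fin n))).filter (fun W => Disjoint W A)).filter (fun W => x ∈ W), (prodBernoulli (fun e : Sym2 (Fin n) => if (∀ y ∈ e, y ∈ S') ∧ ¬ e.IsDiag then (1 : unitInterval) else if (∃ y ∈ e, y ∈ ({x} : Finset (Fin n))) then 0 else u e)).real {ω : BondConfig (Fin n) | ∀ z : Fin n, (z ∈ (W.erase x) ↔ ω ∈ ⋃ t ∈ (S.erase x ∪ S'), openConn t z)}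
            * (prodBernoulli (fun e : Sym2 (Fin n) => if ∃ y ∈ ({x} : Finset (Fin n)), y ∈ e then (0 : unitInterval) else u e)).real (openConnIn ((↑(W.erase x) : Set (Fin n))ᶜ) (sel (insert x (W.erase x))) b) =
        ∑ W' ∈ ((Finset.univ : Finset (Finset (Fin n))).filter (fun W => Disjoint W A)), (prodBernoulli (fun e : Sym2 (Fin n) => if (∀ y ∈ e, y ∈ S') ∧ ¬ e.IsDiag then (1 : unitInterval) else if (∃ y ∈ e, y ∈ ({x} : Finset (Fin n))) then 0 else u e)).real {ω : BondConfig (Fin n) | ∀ z : Fin n, (z ∈ W' ↔ ω ∈ ⋃ t ∈ (S.erase x ∪ S'), openConn t z)}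
            * (prodBernoulli (fun e : Sym2 (Fin n) => if ∃ y ∈ ({x} : Finset (Fin n)), y ∈ e then (0 : unitInterval) else u e)).real (openConnIn ((W' : Set (Fin n))ᶜ) (sel (insert x W')) b) := by
      intro S' hxS'
      have hxT : x ∉ (S.erase x ∪ S') := by
        rw [Finset.mem_union, Finset.mem_erase, not_or]
        exact ⟨fun h => h.1 rfl, hxS'⟩
      rw [← Finset.sum_filter_add_sum_filter_not ((Finset.univ : Finset (Finset (Fin n))).filter (fun W => Disjoint W A)) (fun W' => x ∈ W')]
      have hzero : ∑ W' ∈ ((Finset.univ : Finset (Finset (Fin n))).filter (fun W => Disjoint W A)).filter (fun W' => x ∈ W'), (prodBernoulli (fun e : Sym2 (Fin n) => if (∀ y ∈ e, y ∈ S') ∧ ¬ e.IsDiag then (1 : unitInterval) else if (∃ y ∈ e, y ∈ ({x} : Finset (Fin n))) then 0 else u e)).real {ω : BondConfig (Fin n) | ∀ z : Fin n, (z ∈ W' ↔ ω ∈ ⋃ t ∈ (S.erase x ∪ S'), openConn t z)}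
          * (prodBernoulli (fun e : Sym2 (Fin n) => if ∃ y ∈ ({x} : Finset (Fin n)), y ∈ e then (0 : unitInterval) else u e)).real (openConnIn ((W' : Set (Fin n))ᶜ) (sel (insert x W')) b) = 0 := by
        refine Finset.sum_eq_zero fun W' hW' => ?_
        rw [peel_real_pocket_eq u S' (S.erase x ∪ S') W' x Finset.subset_union_right,
          peel_real_childPocket_eq_zero u (S.erase x ∪ S') W' x hxT (Finset.mem_filter.1 hW').2, zero_mul]
      rw [hzero, zero_add]
      refine Finset.sum_nbij' (fun W => W.erase x) (fun W' => insert x W') (fun W hW => ?_) (fun W' hW' => ?_)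
        (fun W hW => ?_) (fun W' hW' => ?_) (fun W hW => ?_)
      · have h := Finset.mem_filter.1 hW
        exact Finset.mem_filter.2 ⟨(hmem𝒟 _).2 (Finset.disjoint_of_subset_left (Finset.erase_subset x W) ((hmem𝒟 W).1 h.1)),
          Finset.notMem_erase x W⟩
      · have h := Finset.mem_filter.1 hW'
        refine Finset.mem_filter.2 ⟨(hmem𝒟 _).2 ?_, Finset.mem_insert_self x W'⟩
        rw [Finset.disjoint_insert_left]
        exact ⟨hxA, (hmem𝒟 W').1 h.1⟩
      · exact Finset.insert_erase (Finset.mem_filter.1 hW).2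
      · exact Finset.erase_insert (Finset.mem_filter.1 hW').2
      · rfl
    rw [h1, Finset.sum_comm]
    refine Finset.sum_congr rfl fun S' _ => ?_
    rw [← Finset.mul_sum]
    by_cases h0 : (prodBernoulli u).real {ω : BondConfig (Fin n) | ∀ y : Fin n, y ∈ S' ↔ (y ∉ ({x} : Finset (Fin n)) ∧ ∃ o ∈ ({x} : Finset (Fin n)), s(o, y) ∈ ω)} = 0
    · rw [h0, zero_mul, zero_mul]
    · rw [h2 S' (hposx S' h0)]
  -- assemble layer by layer
  rw [hL1, hL2, hY, hPsum, ← Finset.sum_add_distrib, ← Finset.sum_add_distrib]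
  refine Finset.sum_le_sum fun S' _ => ?_
  rw [← mul_add, ← mul_add]
  by_cases h0 : (prodBernoulli u).real {ω : BondConfig (Fin n) | ∀ y : Fin n, y ∈ S' ↔ (y ∉ ({x} : Finset (Fin n)) ∧ ∃ o ∈ ({x} : Finset (Fin n)), s(o, y) ∈ ω)} = 0
  · rw [h0, zero_mul, zero_mul]
  · refine mul_le_mul_of_nonneg_left ?_ measureReal_nonneg
    have hxS' := hposx S' h0
    have hST : S' ⊆ (S.erase x ∪ S') := Finset.subset_union_right
    rw [peel_real_lhs_eq u S' (S.erase x ∪ S') x a₀ b hST, peel_real_reach_eq u S' (S.erase x ∪ S') x b hST]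
    simp only [peel_real_pocket_eq u S' (S.erase x ∪ S') _ x hST]
    exact hlayers S' h0

end BlockGoodPeel

open Literature.Probability.LatticeModels Literature.Probability.Percolation in
/-- Registered helper stub `stub_blockGoodPeel_sp` (stub-plan prover; STUB-PLAN Line A, H5): block goodness of `S` in `u` from block
goodness of the children `(S.erase x) ∪ S'` in `u − x` over the positive layers `S'` of the open star of a block vertex `x ∉ A`
(= `blockGood_peel`).  With the leaves `blockGood_leaf_lemma5` / `blockGood_leaf_ih` this is the peeling-certificate calculus of the
plan's Line A. [cite: KozmaNitzan2024, §3.2 (pp. 12–14)] -/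
theorem stub_blockGoodPeel_sp : ∀ (n : ℕ) (u : Sym2 (Fin n) → unitInterval) (A S : Finset (Fin n)) (b a₀ x : Fin n) (sel : Finset (Fin n) → Fin n), x ∈ S → x ∉ A → b ∈ A → a₀ ∈ A → (∀ W, sel W ∈ A) → (∀ S' : Finset (Fin n), (prodBernoulli u).real {ω : BondConfig (Fin n) | ∀ y : Fin n, y ∈ S' ↔ (y ∉ ({x} : Finset (Fin n)) ∧ ∃ o ∈ ({x} : Finset (Fin n)), s(o, y) ∈ ω)} ≠ 0 → (prodBernoulli (fun e : Sym2 (Fin n) => if ∃ y ∈ ({x} : Finset (Fin n)), y ∈ e then (0 : unitInterval) else u e)).real (openConn a₀ b) + (prodBernoulli (fun e : Sym2 (Fin n) => if ∃ y ∈ ({x} : Finset (Fin n)), y ∈ e then (0 : unitInterval) else u e)).real ((openConn a₀ b)ᶜ ∩ (⋃ t ∈ (S.erase x ∪ S'), openConn a₀ t) ∩ (⋃ t ∈ (S.erase x ∪ S'), openConn t b)) ≤ (prodBernoulli (fun e : Sym2 (Fin n) => if ∃ y ∈ ({x} : Finset (Fin n)), y ∈ e then (0 : unitInterval) else u e)).real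 (⋃ t ∈ (S.erase x ∪ S'), openConn t b) + ∑ W' ∈ ((Finset.univ : Finset (Finset (Fin n))).filter (fun W => Disjoint W A)), (prodBernoulli (fun e : Sym2 (Fin n) => if ∃ y ∈ ({x} : Finset (Fin n)), y ∈ e then (0 : unitInterval) else u e)).real {ω : BondConfig (Fin n) | ∀ z : Fin n, (z ∈ W' ↔ ω ∈ ⋃ t ∈ (S.erase x ∪ S'), openConn t z)} * (prodBernoulli (fun e : Sym2 (Fin n) => if ∃ y ∈ ({x} : Finset (Fin n)), y ∈ e then (0 : unitInterval) else u e)).real (openConnIn ((W' : Set (Fin n))ᶜ) (sel (insert x W')) b)) → (prodBernoulli u).real (openConn a₀ b) + (prodBernoulli u).real ((openConn a₀ b)ᶜ ∩ (⋃ s ∈ S, openConn a₀ s) ∩ (⋃ s ∈ S, openConn s b)) ≤ (prodBernoulli u).real (⋃ s ∈ S, openConn s b) + ∑ W ∈ ((Finset.univ : Finset (Finset (Fin n))).filter (fun W => Disjoint W A)), (prodBernoulli u).real {ω : BondConfig (Fin n) | ∀ z : Fin n, (z ∈ W ↔ ω ∈ ⋃ s ∈ S, openConn s z)} * (prodBernoulli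 u).real (openConnIn ((W : Set (Fin n))ᶜ) (sel W) b) :=
  fun _ u A S b a₀ x sel hx hxA hbA ha₀A hsel hlayers => blockGood_peel u A S b a₀ x sel hx hxA hbA ha₀A hsel hlayers

end

end Summit.CriticalPhenomena.PercolationContinuityZ3.Theorems
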